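import Literature.NumberTheory.Automorphic.CongruenceSubgroupPropertySL2SymbolSq
import HarnessLib

/-!
# Serre's congruence subgroup property for `SL₂(𝓞_F)` — proofs, XVI: Liehl's (11), Cases 1–3

Topic `Literature/NumberTheory/Automorphic`; namespace `Literature.NumberTheory.Automorphic.SL2Rel`.
Everything here is PROVED; no definitions.

**Liehl (11)** for the pair `(𝔮, A)`: *let `0 ≠ z ∈ 𝔮`, `I' = z²A`; if `(a, b₁)`, `(a, b₂)` are first
rows of matrices `(a b₁; * *)`, `(a b₂; c d) ∈ G(I', I')`, then `[b₁ over a][b₂ over a] = [b₁b₂ over a]`.*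
This file: the reduction `[b₁ over a][b₂ over a] = [a(b₁ - c) over ad - b₁b₂]` by (9)
(`sym_mul_sym_eq_sym`), the common ending of Cases 1 and 2 (`sym_case_end`), **Case 1**
(`b₁ - c = x²`, `x ∈ zA`; `sym_case1`), **Case 2** (`b₂ = x²`; `sym_case2`) and **Case 3** (a solution
of `b₁u² + b₂v² ≡ w² (mod a)` with `u, v` units mod `a`, encoded by the lifts `x₀, y₀ ∈ zA` of
`b₂⁻¹uv⁻¹`, `wu⁻¹` with `b₁b₂x₀² - y₀²x₀²b₂ + 1 ≡ 0 (mod a)`; `sym_case3`), all as printed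
(Liehl pp. 158–159).  The general case (choice of a prime `a' ≡ a` with residue field `≠ 𝔽₃` and
the conic over it) is the next file.

## References

* [Liehl1981SL2Orders] B. Liehl, J. reine angew. Math. 323 (1981) 153–171, §3 (11).
-/

open Matrix MatrixGroups NumberField

namespace Literature.NumberTheory.Automorphic

namespace SL2Rel

section NumberField

variable {K : Type} [Field K] [NumberField K]
variable (hreal : ∃ w : InfinitePlace K, w.IsReal) (hunit : ∃ v : (𝓞 K)ˣ, ∀ n : ℕ, n ≠ 0 → v ^ n ≠ 1)
include hreal hunit

/-- **The first step of (11)**: for `(a, b₁) ∈ W(𝔮, A)` and `α₂ = (a b₂; c d) ∈ G(I, I)`,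
`0 ≠ I ⊆ 𝔮`: `[b₁ over a][b₂ over a] = [a(b₁ - c) over ad - b₁b₂]`, because by (9)
`(d -c; -b₂ a) = w⁻¹ α₂ w ∈ α₂ E(I, I)`. [cite: Liehl1981SL2Orders, §3 (11) (proof)] -/
theorem sym_mul_sym_eq_sym {𝔮 I : Ideal (𝓞 K)} (hI : I ≠ ⊥) (hI𝔮 : I ≤ 𝔮) {a b₁ : 𝓞 K}
    (ha : a - 1 ∈ 𝔮) (hb₁ : b₁ ∈ 𝔮) (hab₁ : IsCoprime a b₁) {α₂ : SL(2, 𝓞 K)}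
    (hα₂ : α₂ ∈ relG I I) (h00 : α₂ 0 0 = a) :
    sym 𝔮 a b₁ * sym 𝔮 a (α₂ 0 1) =
      sym 𝔮 (a * α₂ 1 1 - b₁ * α₂ 0 1) (a * (b₁ - α₂ 1 0)) := by
  obtain ⟨α₁, h10, h11, hs1⟩ := exists_sym_eq_mk ha hb₁ hab₁
  have hα₂' : α₂ ∈ relG 𝔮 ⊤ := relG_mono hI𝔮 le_top hα₂
  obtain ⟨k00, k01, k10, k11⟩ := weylElt_inv_mul_mul_apply α₂
  set β : SL(2, 𝓞 K) := weylElt⁻¹ * α₂ * weylElt with hβ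
  have hβG : β ∈ relG 𝔮 ⊤ := by
    refine ⟨?_, Submodule.mem_top, ?_, ?_⟩
    · rw [k01]; exact 𝔮.neg_mem (hI𝔮 hα₂.2.1)
    · rw [k00, Ideal.mul_top]; exact (Ideal.mul_le_right.trans hI𝔮) hα₂.2.2.2
    · rw [k11, Ideal.mul_top, h00]; exact ha
  have hβα : ((⟨β, hβG⟩ : relG 𝔮 ⊤) : SymbGroup 𝔮) = (⟨α₂, hα₂'⟩ : relG 𝔮 ⊤) := by
    have h9 := weyl_commutator_mem_relE hreal hunit hI hα₂
    rw [QuotientGroup.eq]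
    apply Subgroup.subset_normalClosure
    rw [SetLike.mem_coe, Subgroup.mem_subgroupOf]
    show β⁻¹ * α₂ ∈ relE 𝔮 ⊤
    rw [show β⁻¹ * α₂ = (α₂⁻¹ * weylElt⁻¹ * α₂ * weylElt)⁻¹ by rw [hβ]; group]
    exact inv_mem (relE_mono hI𝔮 le_top h9)
  rw [hs1, sym_eq_mk ⟨α₂, hα₂'⟩ h00 rfl, ← hβα, ← QuotientGroup.mk_mul]
  refine (sym_eq_mk (α₁ * ⟨β, hβG⟩) ?_ ?_).symm
  · simp only [Subgroup.coe_mul, mul_apply_two, h10, h11, k00, k10]; ring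
  · simp only [Subgroup.coe_mul, mul_apply_two, h10, h11, k01, k11, h00]; ring

omit [NumberField K] hreal hunit in
/-- `a ≡ 1 (mod zt)` gives `(a, z) = 1`. [folklore] -/
private theorem isCoprime_of_sub_one_mem {a z t : 𝓞 K} (h : a - 1 ∈ Ideal.span {z * t}) :
    IsCoprime a z := by
  obtain ⟨s, hs⟩ := Ideal.mem_span_singleton'.1 h
  exact ⟨1, -(s * t), by linear_combination -hs⟩

/-- **The common ending of Cases 1 and 2 of (11)**: for `a - 1, D - 1 ∈ z⁴A`, `D = ad - b`,
`(D, a) = (a, b) = 1`:  `[az² over D] = [-Dz² over a] = [z²b over a] = [b over a]` by (10), (6), (8).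
[cite: Liehl1981SL2Orders, §3 (11) (proof, Case 1)] -/
theorem sym_case_end {𝔮 : Ideal (𝓞 K)} {z : 𝓞 K} (hz : z ∈ 𝔮) (hz0 : z ≠ 0) {a d b D : 𝓞 K}
    (ha : a - 1 ∈ Ideal.span {z * z * (z * z)}) (hD : D - 1 ∈ Ideal.span {z * z * (z * z)})
    (hDdef : D = a * d - b) (hb : b ∈ 𝔮) (hDa : IsCoprime D a) (hab : IsCoprime a b) :
    sym 𝔮 D (a * (z * z)) = sym 𝔮 a b := by
  have h𝔮 : 𝔮 ≠ ⊥ := fun h ↦ hz0 (by rw [h] at hz; exact hz)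
  have hzz : z * z ∈ 𝔮 := 𝔮.mul_mem_left _ hz
  have ha𝔮 : a - 1 ∈ 𝔮 :=
    (Ideal.span_singleton_le_iff_mem _).2 (𝔮.mul_mem_left _ hzz) ha
  have haz : IsCoprime a z := isCoprime_of_sub_one_mem (t := z * (z * z)) (by simpa [mul_assoc] using ha)
  -- (10)
  have s1 : sym 𝔮 D (a * (z * z)) = sym 𝔮 a (-(D * (z * z))) :=
    sym_mul_eq_sym_neg_mul hreal hunit h𝔮 hzz hD ha hDa
  -- (6): `z²b = -Dz² + (z²d) a`
  have hazz : IsCoprime a (-(D * (z * z))) :=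
    (hDa.symm.mul_right (haz.mul_right haz)).neg_right
  have s2 : sym 𝔮 a (z * z * b) = sym 𝔮 a (-(D * (z * z))) := by
    rw [show z * z * b = -(D * (z * z)) + (z * z * d) * a by rw [hDdef]; ring]
    exact sym_add_mul_right ha𝔮 (𝔮.neg_mem (𝔮.mul_mem_left _ hzz)) hazz (𝔮.mul_mem_right _ hzz)
  -- (8)
  have ha8 : a - 1 ∈ 𝔮 * Ideal.span {z * z} := by
    obtain ⟨s, hs⟩ := Ideal.mem_span_singleton'.1 ha
    rw [← hs, show s * (z * z * (z * z)) = (s * (z * z)) * (z * z) by ring]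
    exact Ideal.mul_mem_mul (𝔮.mul_mem_left _ hzz) (Ideal.mem_span_singleton_self _)
  have s3 : sym 𝔮 a (z * z * b) = sym 𝔮 a b := sym_sq_mul_eq hreal hunit h𝔮 z ha8 hb hab
  rw [s1, ← s2, s3]

/-- **(11), Case 1**: `b₁ - c = x²`, `x = zx₁ ∈ zA`, so that `D - 1 = -b₂x²`:
`[ax² over D] = [az² over D]` by (8), then the common ending. [cite: Liehl1981SL2Orders, §3 (11) Case 1] -/
theorem sym_case1 {𝔮 : Ideal (𝓞 K)} {z : 𝓞 K} (hz : z ∈ 𝔮) (hz0 : z ≠ 0)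
    {a d b₁ b₂ D x₁ : 𝓞 K} (ha : a - 1 ∈ Ideal.span {z * z * (z * z)})
    (hb₂ : b₂ ∈ Ideal.span {z * z}) (hDeq : D - 1 = -(b₂ * (z * x₁ * (z * x₁))))
    (hDdef : D = a * d - b₁ * b₂) (hb : b₁ * b₂ ∈ 𝔮) (hDa : IsCoprime D a)
    (hab : IsCoprime a (b₁ * b₂)) :
    sym 𝔮 D (a * (z * x₁ * (z * x₁))) = sym 𝔮 a (b₁ * b₂) := by
  have h𝔮 : 𝔮 ≠ ⊥ := fun h ↦ hz0 (by rw [h] at hz; exact hz)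
  have hzz : z * z ∈ 𝔮 := 𝔮.mul_mem_left _ hz
  obtain ⟨b₂', hb₂'⟩ := Ideal.mem_span_singleton'.1 hb₂
  have haz : IsCoprime a z := isCoprime_of_sub_one_mem (t := z * (z * z)) (by simpa [mul_assoc] using ha)
  have hDz : IsCoprime D z := by
    refine isCoprime_of_sub_one_mem (t := -(b₂ * z * x₁ * x₁)) ?_
    rw [hDeq]; exact Ideal.mem_span_singleton'.2 ⟨1, by ring⟩
  -- (8) with `y = x₁`
  have hD8 : D - 1 ∈ 𝔮 * Ideal.span {x₁ * x₁} := by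
    rw [hDeq, show -(b₂ * (z * x₁ * (z * x₁))) = (-(b₂ * (z * z))) * (x₁ * x₁) by ring]
    exact Ideal.mul_mem_mul (𝔮.neg_mem (𝔮.mul_mem_left _ hzz)) (Ideal.mem_span_singleton_self _)
  have hDazz : IsCoprime D (a * (z * z)) := hDa.mul_right (hDz.mul_right hDz)
  have s0 : sym 𝔮 D (x₁ * x₁ * (a * (z * z))) = sym 𝔮 D (a * (z * z)) :=
    sym_sq_mul_eq hreal hunit h𝔮 x₁ hD8 (𝔮.mul_mem_left _ hzz) hDazz
  rw [show a * (z * x₁ * (z * x₁)) = x₁ * x₁ * (a * (z * z)) by ring, s0]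
  -- the common ending
  refine sym_case_end hreal hunit hz hz0 ha ?_ hDdef hb hDa hab
  rw [hDeq, ← hb₂']
  exact Ideal.mem_span_singleton'.2 ⟨-(b₂' * x₁ * x₁), by ring⟩

/-- **(11), Case 2**: `b₂ = x²` (and `b₂ ∈ z²A`), `E = b₁ - c ∈ z²A`, `D = 1 - b₂E = ad - b₁b₂`:
`[aE over D] = [z²aE over D] = [b₂z²aE over D] = [az² over D]` by (8), (8), (6), then the common
ending. [cite: Liehl1981SL2Orders, §3 (11) Case 2] -/
theorem sym_case2 {𝔮 : Ideal (𝓞 K)} {z : 𝓞 K} (hz : z ∈ 𝔮) (hz0 : z ≠ 0)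
    {a d b₁ b₂ D x E : 𝓞 K} (ha : a - 1 ∈ Ideal.span {z * z * (z * z)})
    (hb₂ : b₂ ∈ Ideal.span {z * z}) (hx : b₂ = x * x) (hE : E ∈ Ideal.span {z * z})
    (hDeq : D = 1 - b₂ * E) (hDdef : D = a * d - b₁ * b₂) (hb : b₁ * b₂ ∈ 𝔮)
    (hDa : IsCoprime D a) (hab : IsCoprime a (b₁ * b₂)) :
    sym 𝔮 D (a * E) = sym 𝔮 a (b₁ * b₂) := by
  have h𝔮 : 𝔮 ≠ ⊥ := fun h ↦ hz0 (by rw [h] at hz; exact hz)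
  have hzz : z * z ∈ 𝔮 := 𝔮.mul_mem_left _ hz
  have hI𝔮 : Ideal.span {z * z} ≤ 𝔮 := (Ideal.span_singleton_le_iff_mem _).2 hzz
  obtain ⟨E', hE'⟩ := Ideal.mem_span_singleton'.1 hE
  obtain ⟨b₂', hb₂'⟩ := Ideal.mem_span_singleton'.1 hb₂
  have hD𝔮 : D - 1 ∈ 𝔮 := by
    rw [hDeq, show 1 - b₂ * E - 1 = -(b₂ * E) by ring]
    exact 𝔮.neg_mem (𝔮.mul_mem_left _ (hI𝔮 hE))
  have hDE : IsCoprime D E := ⟨1, b₂, by rw [hDeq]; ring⟩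
  have hDz : IsCoprime D z := by
    refine isCoprime_of_sub_one_mem (t := -(b₂ * E' * z)) ?_
    rw [hDeq, ← hE']; exact Ideal.mem_span_singleton'.2 ⟨1, by ring⟩
  have hDaE : IsCoprime D (a * E) := hDa.mul_right hDE
  -- (8) with `y = z`
  have hD8 : D - 1 ∈ 𝔮 * Ideal.span {z * z} := by
    rw [hDeq, show 1 - b₂ * E - 1 = (-b₂) * E by ring, ← hE']
    exact Ideal.mul_mem_mul (𝔮.neg_mem (hI𝔮 hb₂)) (Ideal.mem_span_singleton'.2 ⟨E', rfl⟩)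
  have s1 : sym 𝔮 D (z * z * (a * E)) = sym 𝔮 D (a * E) :=
    sym_sq_mul_eq hreal hunit h𝔮 z hD8 (𝔮.mul_mem_left _ (hI𝔮 hE)) hDaE
  -- (8) with `y = x`
  have hD8' : D - 1 ∈ 𝔮 * Ideal.span {x * x} := by
    rw [hDeq, show 1 - b₂ * E - 1 = (-E) * (x * x) by rw [hx]; ring]
    exact Ideal.mul_mem_mul (𝔮.neg_mem (hI𝔮 hE)) (Ideal.mem_span_singleton_self _)
  have hDzaE : IsCoprime D (z * z * (a * E)) := (hDz.mul_right hDz).mul_right hDaE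
  have s2 : sym 𝔮 D (x * x * (z * z * (a * E))) = sym 𝔮 D (z * z * (a * E)) :=
    sym_sq_mul_eq hreal hunit h𝔮 x hD8' (𝔮.mul_mem_left _ (𝔮.mul_mem_left _ (hI𝔮 hE))) hDzaE
  -- (6): `az² = x²z²aE + (az²) D`
  have hDb₂ : IsCoprime D b₂ := ⟨1, E, by rw [hDeq]; ring⟩
  have hDall : IsCoprime D (x * x * (z * z * (a * E))) := by rw [← hx]; exact hDb₂.mul_right hDzaE
  have s3 : sym 𝔮 D (a * (z * z)) = sym 𝔮 D (x * x * (z * z * (a * E))) := by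
    rw [show a * (z * z) = x * x * (z * z * (a * E)) + (a * (z * z)) * D by rw [hDeq, hx]; ring]
    exact sym_add_mul_right hD𝔮 (𝔮.mul_mem_left _ (𝔮.mul_mem_left _ (𝔮.mul_mem_left _ (hI𝔮 hE))))
      hDall (𝔮.mul_mem_left _ hzz)
  rw [← s1, ← s2, ← s3]
  refine sym_case_end hreal hunit hz hz0 ha ?_ hDdef hb hDa hab
  rw [hDeq, show 1 - b₂ * E - 1 = -(b₂ * E) by ring, ← hb₂', ← hE']
  exact Ideal.mem_span_singleton'.2 ⟨-(b₂' * E'), by ring⟩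

omit [NumberField K] hreal hunit in
/-- If `D = ad - m` with `(a, m) = 1` then `(D, a) = 1`. [folklore] -/
private theorem isCoprime_of_eq_sub {a d m D : 𝓞 K} (hD : D = a * d - m) (ham : IsCoprime a m) :
    IsCoprime D a := by
  have h : IsCoprime a (-m + a * d) := ham.neg_right.add_mul_left_right d
  rw [show -m + a * d = D by rw [hD]; ring] at h
  exact h.symm

/-- **(11), Case 3**: `(a, b₁), (a, b₂)` rows of `G(z²A, z²A)`, and `x₀, y₀ ∈ zA` with
`b₁b₂x₀² - y₀²x₀²b₂ + 1 ≡ 0 (mod a)`, `(a, x₀) = 1` (lifts of `b₂⁻¹uv⁻¹`, `wu⁻¹` for a solution of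
`b₁u² + b₂v² ≡ w²`).  With `c' = b₁ - y₀²`, `d' = (c'b₂x₀² + 1)/a`, `(a, b₂x₀²; c', d') ∈ G(z²A, z²A)`;
Case 1 gives `[b₁][b₂x₀²] = [b₁b₂x₀²]`, Case 2 gives `[b₂x₀²] = [b₂][x₀²]`, `[b₁b₂x₀²] = [b₁b₂][x₀²]`.
[cite: Liehl1981SL2Orders, §3 (11) Case 3] -/
theorem sym_case3 {𝔮 : Ideal (𝓞 K)} {z : 𝓞 K} (hz : z ∈ 𝔮) (hz0 : z ≠ 0) {a b₁ b₂ x₀ y₀ : 𝓞 K}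
    (ha : a - 1 ∈ Ideal.span {z * z * (z * z)}) (hb₁ : b₁ ∈ Ideal.span {z * z})
    (hb₂ : b₂ ∈ Ideal.span {z * z}) (hab₁ : IsCoprime a b₁) (hab₂ : IsCoprime a b₂)
    (hx₀ : x₀ ∈ Ideal.span {z}) (hy₀ : y₀ ∈ Ideal.span {z})
    (hrel : b₁ * b₂ * x₀ * x₀ - y₀ * y₀ * x₀ * x₀ * b₂ + 1 ∈ Ideal.span {a})
    (hax₀ : IsCoprime a x₀) :
    sym 𝔮 a b₁ * sym 𝔮 a b₂ = sym 𝔮 a (b₁ * b₂) := by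
  have h𝔮 : 𝔮 ≠ ⊥ := fun h ↦ hz0 (by rw [h] at hz; exact hz)
  have hzz : z * z ∈ 𝔮 := 𝔮.mul_mem_left _ hz
  set I : Ideal (𝓞 K) := Ideal.span {z * z} with hI
  have hI0 : I ≠ ⊥ := by rw [hI, Ne, Ideal.span_singleton_eq_bot]; exact mul_ne_zero hz0 hz0
  have hI𝔮 : I ≤ 𝔮 := (Ideal.span_singleton_le_iff_mem _).2 hzz
  have hII : I * I = Ideal.span {z * z * (z * z)} := Ideal.span_singleton_mul_span_singleton _ _
  have haII : a - 1 ∈ I * I := by rwa [hII]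
  have ha𝔮 : a - 1 ∈ 𝔮 := (Ideal.mul_le_right.trans hI𝔮) haII
  obtain ⟨x₁, hx₁⟩ := Ideal.mem_span_singleton'.1 hx₀
  obtain ⟨y₁, hy₁⟩ := Ideal.mem_span_singleton'.1 hy₀
  have hx₀₀ : x₀ * x₀ ∈ I := Ideal.mem_span_singleton'.2 ⟨x₁ * x₁, by rw [← hx₁]; ring⟩
  -- the matrix `(a, b₂x₀²; c', d')`
  set c' := b₁ - y₀ * y₀ with hc'
  have hc'I : c' ∈ I := I.sub_mem hb₁ (Ideal.mem_span_singleton'.2 ⟨y₁ * y₁, by rw [← hy₁]; ring⟩)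
  obtain ⟨d', hd'⟩ := Ideal.mem_span_singleton'.1 hrel
  have hdet : a * d' - b₂ * (x₀ * x₀) * c' = 1 := by rw [hc']; linear_combination hd'
  set α₂ : SL(2, 𝓞 K) := ⟨!![a, b₂ * (x₀ * x₀); c', d'], by rw [Matrix.det_fin_two_of]; exact hdet⟩
    with hα₂
  have hα₂G : α₂ ∈ relG I I := by
    refine ⟨I.mul_mem_right _ hb₂, hc'I, haII, ?_⟩
    show d' - 1 ∈ I * I
    rw [show d' - 1 = -(d' * (a - 1)) + b₂ * (x₀ * x₀) * c' by linear_combination hdet]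
    exact (I * I).add_mem ((I * I).neg_mem (Ideal.mul_mem_left _ _ haII))
      (Ideal.mul_mem_mul (I.mul_mem_right _ hb₂) hc'I)
  -- Case 1: `[b₁][b₂x₀²] = [b₁b₂x₀²]`
  have hab₂x : IsCoprime a (b₂ * (x₀ * x₀)) := hab₂.mul_right (hax₀.mul_right hax₀)
  have E1 : sym 𝔮 a b₁ * sym 𝔮 a (b₂ * (x₀ * x₀)) = sym 𝔮 a (b₁ * (b₂ * (x₀ * x₀))) := by
    have h := sym_mul_sym_eq_sym hreal hunit hI0 hI𝔮 ha𝔮 (hI𝔮 hb₁) hab₁ hα₂G rfl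
    simp only [hα₂] at h
    change sym 𝔮 a b₁ * sym 𝔮 a (b₂ * (x₀ * x₀)) =
      sym 𝔮 (a * d' - b₁ * (b₂ * (x₀ * x₀))) (a * (b₁ - c')) at h
    rw [h, show b₁ - c' = z * y₁ * (z * y₁) by rw [hc', ← hy₁]; ring]
    have hDeq : a * d' - b₁ * (b₂ * (x₀ * x₀)) - 1 = -(b₂ * (x₀ * x₀) * (z * y₁ * (z * y₁))) := by
      rw [hc'] at hdet
      linear_combination hdet + (b₂ * (x₀ * x₀) * (z * y₁ + y₀)) * hy₁
    refine sym_case1 hreal hunit hz hz0 ha (I.mul_mem_right _ hb₂) hDeq rfl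
      (𝔮.mul_mem_left _ (𝔮.mul_mem_right _ (hI𝔮 hb₂))) ?_ (hab₁.mul_right hab₂x)
    exact isCoprime_of_eq_sub rfl (hab₁.mul_right hab₂x)
  -- Case 2: `[B][x₀²] = [Bx₀²]` for `B = b₂, b₁b₂`
  have E2 : ∀ B : 𝓞 K, B ∈ I → IsCoprime a B →
      sym 𝔮 a B * sym 𝔮 a (x₀ * x₀) = sym 𝔮 a (B * (x₀ * x₀)) := by
    intro B hBI haB
    obtain ⟨α₃, hα₃, h30, h31⟩ := exists_relG_of_row haII hx₀₀ (hax₀.mul_right hax₀)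
    have h := sym_mul_sym_eq_sym hreal hunit hI0 hI𝔮 ha𝔮 (hI𝔮 hBI) haB hα₃ h30
    rw [h31] at h
    rw [h]
    have hdet₃ : a * α₃ 1 1 - x₀ * x₀ * α₃ 1 0 = 1 := by
      have := det_two α₃; rwa [h30, h31] at this
    refine sym_case2 hreal hunit hz hz0 ha hx₀₀ rfl (I.sub_mem hBI hα₃.2.1) ?_ rfl
      (𝔮.mul_mem_right _ (hI𝔮 hBI)) ?_ (haB.mul_right (hax₀.mul_right hax₀))
    · linear_combination hdet₃
    · exact isCoprime_of_eq_sub rfl (haB.mul_right (hax₀.mul_right hax₀))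
  have E2a := E2 b₂ hb₂ hab₂
  have E2b := E2 (b₁ * b₂) (I.mul_mem_left _ hb₂) (hab₁.mul_right hab₂)
  -- together
  rw [mul_assoc] at E2b
  have : sym 𝔮 a b₁ * sym 𝔮 a b₂ * sym 𝔮 a (x₀ * x₀) = sym 𝔮 a (b₁ * b₂) * sym 𝔮 a (x₀ * x₀) := by
    rw [mul_assoc, E2a, E1, ← E2b]
  exact mul_right_cancel this

end NumberField

end SL2Rel

end Literature.NumberTheory.Automorphic
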